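import Summits.NavierStokesRegularity.NavierStokesRegularity.Theorems.EfficiencyFloorNearSaturationNearMaximiserSeqCoreEulerLagrange
import Mathlib.Analysis.Calculus.DerivativeTest
import Literature.Analysis.FluidPDE.NSStrongSpeedBound
import HarnessLib

/-!
# Route `EfficiencyFloor`, ladder of `ProductionEfficiencyDecay` (stmt-22866): the SECOND VARIATION inequality of the
# Lu–Doering extremisers (cruxes `MaximiserSetRigidity` stmt-25512 / `NearSaturationNearMaximiser` stmt-25482)

Def-free helper file, companion of `…SeqCoreEulerLagrange`. `MaximiserSetRigidity` (a) bets that the maximiser set of the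
Lu–Doering efficiency is finitely many symmetry orbits; its recorded failure mode is a DEGENERATE second variation («a continuum of
non-equivalent maximisers»). The object of that analysis is the second variation, whose necessary sign condition this file proves
in the tree's smooth admissible framework. Along the admissible segment `s ↦ m + sh` the two-sided sharp inequality
`|S| ≤ c Z^{3/4} Pal^{3/4}` is the POLYNOMIAL inequality `p(s) = c⁴ Z(s)³ Pal(s)³ − S(s)⁴ ≥ 0` (degree 12 in `s`), with `p(0) = 0` at
a saturating `m`; hence `p'(0) = 0` (Euler–Lagrange again) and `p''(0) ≥ 0`:

* `hasDerivAt_quad`, `hasDerivAt_cub`, `hasDerivAt_constraintPoly`, `hasDerivAt_constraintPoly_deriv_zero` — the calculus;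
* `secondOrder_of_min` — a differentiable function with a global minimum at `0` and `p'` differentiable at `0` has `p''(0) ≥ 0`
  (by the second-derivative test run backwards);
* `abs_stretching_le` — the two-sided bound `|S(v)| ≤ c Z(v)^{3/4} Pal(v)^{3/4}` on the admissible class (`v ↦ −v`);
* `secondVariation_of_maximiser` — **second variation inequality**: for an admissible `m` with `Z, Pal > 0` saturating an admissible
  constant `c` and every admissible `h`,
  `0 ≤ c⁴(24 Z B² P³ + 6 Z² Z(h) P³ + 72 Z² P² B P₁ + 24 Z³ P P₁² + 6 Z³ P² Pal(h)) − 12 S² S₁² − 8 S³ S₂`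
  (`Z, P, S` at `m`; `B, P₁, S₁, S₂` the mixed terms of `…SeqCoreEulerLagrange`);
* `secondVariation_of_normalisedMaximiser` — normal form `Z = Pal = 1`, `S = c > 0`, with the Euler–Lagrange identity substituted:
  `8 S₂(m;h) ≤ c (6 (Z(h) + Pal(h)) + 18 B P₁ − 3 B² − 3 P₁²)` — the stability (negative semi-definiteness) of the constrained
  Hessian of `S/(Z Pal)^{3/4}` at a maximiser, tested on admissible directions.

HONEST FRAMING: necessary conditions on maximisers IF they exist; `MaximiserSetRigidity` (stmt-25512), `NearSaturationNearMaximiser`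
(stmt-25482), `ProductionEfficiencyDecay` (stmt-22866) and Navier–Stokes regularity stay OPEN; no summit statement is proved.
[cite: LuDoering2008, §3]
-/

-- the problem directory repeats the summit name (`NavierStokesRegularity/NavierStokesRegularity`)
set_option linter.dupNamespace false

noncomputable section

namespace Summit.NavierStokesRegularity.NavierStokesRegularity.Theorems

namespace NearSaturationNearMaximiser

namespace SeqCore

open Set MeasureTheory Filter Topology Function
open scoped InnerProductSpace ENNReal
open Literature.Analysis.FluidPDE

/-! ## §1 Calculus: the constraint polynomial along a segment -/

/-- Derivative of the real quadratic `a + 2sb + s²e` at every point. [folklore] -/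
theorem hasDerivAt_quad (a b e s : ℝ) : HasDerivAt (fun s : ℝ => a + 2 * s * b + s ^ 2 * e) (2 * b + 2 * s * e) s := by
  have h1 : HasDerivAt (fun s : ℝ => 2 * s * b) (2 * 1 * b) s := ((hasDerivAt_id s).const_mul 2).mul_const b
  have h2 : HasDerivAt (fun s : ℝ => s ^ 2 * e) (((2 : ℕ) : ℝ) * s ^ (2 - 1) * e) s := (hasDerivAt_pow 2 s).mul_const e
  have h := (h1.const_add a).fun_add h2
  refine h.congr_deriv ?_
  simp only [Nat.cast_ofNat, mul_one]
  ring

/-- Derivative of the real cubic `a + sb + s²e + s³d` at every point. [folklore] -/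
theorem hasDerivAt_cub (a b e d s : ℝ) :
    HasDerivAt (fun s : ℝ => a + s * b + s ^ 2 * e + s ^ 3 * d) (b + 2 * s * e + 3 * s ^ 2 * d) s := by
  have h1 : HasDerivAt (fun s : ℝ => s * b) (1 * b) s := (hasDerivAt_id s).mul_const b
  have h2 : HasDerivAt (fun s : ℝ => s ^ 2 * e) (((2 : ℕ) : ℝ) * s ^ (2 - 1) * e) s := (hasDerivAt_pow 2 s).mul_const e
  have h3 : HasDerivAt (fun s : ℝ => s ^ 3 * d) (((3 : ℕ) : ℝ) * s ^ (3 - 1) * d) s := (hasDerivAt_pow 3 s).mul_const d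
  have h := ((h1.const_add a).fun_add h2).fun_add h3
  refine h.congr_deriv ?_
  simp only [Nat.cast_ofNat, one_mul]
  ring

/-- The constraint polynomial `p(s) = k·q₁(s)³q₂(s)³ − w(s)⁴` (quadratics `q₁, q₂`, cubic `w`) and its derivative at every point. [folklore] -/
theorem hasDerivAt_constraintPoly (k Z0 B Zh P0 P1 Ph S0 S1 S2 S3 s : ℝ) :
    HasDerivAt (fun s : ℝ => k * (Z0 + 2 * s * B + s ^ 2 * Zh) ^ 3 * (P0 + 2 * s * P1 + s ^ 2 * Ph) ^ 3 -
        (S0 + s * S1 + s ^ 2 * S2 + s ^ 3 * S3) ^ 4)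
      (k * (3 * (Z0 + 2 * s * B + s ^ 2 * Zh) ^ 2 * (2 * B + 2 * s * Zh)) * (P0 + 2 * s * P1 + s ^ 2 * Ph) ^ 3 +
        k * (Z0 + 2 * s * B + s ^ 2 * Zh) ^ 3 * (3 * (P0 + 2 * s * P1 + s ^ 2 * Ph) ^ 2 * (2 * P1 + 2 * s * Ph)) -
        4 * (S0 + s * S1 + s ^ 2 * S2 + s ^ 3 * S3) ^ 3 * (S1 + 2 * s * S2 + 3 * s ^ 2 * S3)) s := by
  have hZ := (hasDerivAt_quad Z0 B Zh s).fun_pow 3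
  have hP := (hasDerivAt_quad P0 P1 Ph s).fun_pow 3
  have hS := (hasDerivAt_cub S0 S1 S2 S3 s).fun_pow 4
  have h := ((hZ.const_mul k).fun_mul hP).fun_sub hS
  refine h.congr_deriv ?_
  simp only [Nat.cast_ofNat]

/-- The derivative at `0` of `p'`: the explicit second derivative `p''(0)` of the constraint polynomial. [folklore] -/
theorem hasDerivAt_constraintPoly_deriv_zero (k Z0 B Zh P0 P1 Ph S0 S1 S2 S3 : ℝ) :
    HasDerivAt (fun s : ℝ => k * (3 * (Z0 + 2 * s * B + s ^ 2 * Zh) ^ 2 * (2 * B + 2 * s * Zh)) *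
        (P0 + 2 * s * P1 + s ^ 2 * Ph) ^ 3 +
        k * (Z0 + 2 * s * B + s ^ 2 * Zh) ^ 3 * (3 * (P0 + 2 * s * P1 + s ^ 2 * Ph) ^ 2 * (2 * P1 + 2 * s * Ph)) -
        4 * (S0 + s * S1 + s ^ 2 * S2 + s ^ 3 * S3) ^ 3 * (S1 + 2 * s * S2 + 3 * s ^ 2 * S3))
      (k * (24 * Z0 * B ^ 2 * P0 ^ 3 + 6 * Z0 ^ 2 * Zh * P0 ^ 3 + 72 * Z0 ^ 2 * P0 ^ 2 * B * P1 +
        24 * Z0 ^ 3 * P0 * P1 ^ 2 + 6 * Z0 ^ 3 * P0 ^ 2 * Ph) - 12 * S0 ^ 2 * S1 ^ 2 - 8 * S0 ^ 3 * S2) 0 := by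
  have hZq := hasDerivAt_quad Z0 B Zh 0
  have hPq := hasDerivAt_quad P0 P1 Ph 0
  have hSc := hasDerivAt_cub S0 S1 S2 S3 0
  -- derivatives of the linear factors
  have hZl : HasDerivAt (fun s : ℝ => 2 * B + 2 * s * Zh) (2 * 1 * Zh) 0 :=
    (((hasDerivAt_id (0 : ℝ)).const_mul 2).mul_const Zh).const_add (2 * B)
  have hPl : HasDerivAt (fun s : ℝ => 2 * P1 + 2 * s * Ph) (2 * 1 * Ph) 0 :=
    (((hasDerivAt_id (0 : ℝ)).const_mul 2).mul_const Ph).const_add (2 * P1)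
  have hSl : HasDerivAt (fun s : ℝ => S1 + 2 * s * S2 + 3 * s ^ 2 * S3) (2 * 1 * S2 + 3 * (((2 : ℕ) : ℝ) * (0 : ℝ) ^ (2 - 1)) * S3) 0 :=
    ((((hasDerivAt_id (0 : ℝ)).const_mul 2).mul_const S2).const_add S1).fun_add
      (((hasDerivAt_pow 2 (0 : ℝ)).const_mul 3).mul_const S3)
  have t1 := (((hZq.fun_pow 2).const_mul 3).fun_mul hZl).const_mul k |>.fun_mul (hPq.fun_pow 3)
  have t2 := ((hZq.fun_pow 3).const_mul k).fun_mul (((hPq.fun_pow 2).const_mul 3).fun_mul hPl)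
  have t3 := (((hSc.fun_pow 3).const_mul 4).fun_mul hSl)
  have h := (t1.fun_add t2).fun_sub t3
  refine h.congr_deriv ?_
  simp only [Nat.cast_ofNat]
  ring

/-- **Second-order necessary condition.** A differentiable `p : ℝ → ℝ` with a global minimum at `0` whose derivative `p'` is
differentiable at `0` has `p'(0) = 0` and `p''(0) ≥ 0` (if `p''(0) < 0` the second-derivative test would make `0` also a local
maximum, so `p` would be locally constant and `p''(0) = 0`). [folklore] -/
theorem secondOrder_of_min {p p' : ℝ → ℝ} {d2 : ℝ} (hp : ∀ s, HasDerivAt p (p' s) s) (hp' : HasDerivAt p' d2 0)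
    (hmin : ∀ s, p 0 ≤ p s) : p' 0 = 0 ∧ 0 ≤ d2 := by
  have hlocmin : IsLocalMin p 0 := Filter.Eventually.of_forall hmin
  have h1 : p' 0 = 0 := hlocmin.hasDerivAt_eq_zero (hp 0)
  refine ⟨h1, ?_⟩
  have hderiv : deriv p = p' := funext fun s => (hp s).deriv
  have hd2 : deriv (deriv p) 0 = d2 := by rw [hderiv]; exact hp'.deriv
  by_contra hneg
  push Not at hneg
  have hmax : IsLocalMax p 0 :=
    isLocalMax_of_deriv_deriv_neg (by rw [hd2]; exact hneg) (by rw [hderiv, h1]) (hp 0).continuousAt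
  -- `p` is locally constant at `0`, so its second derivative there vanishes
  have hconst : p =ᶠ[𝓝 0] fun _ => p 0 := by
    filter_upwards [hmax] with s hs using le_antisymm hs (hmin s)
  have hd0 : deriv (deriv p) 0 = 0 := by
    have h := hconst.deriv
    have h' : deriv p =ᶠ[𝓝 0] fun _ => (0 : ℝ) := by
      filter_upwards [h] with s hs
      rw [hs, deriv_const]
    rw [h'.deriv_eq, deriv_const]
  rw [hd2] at hd0
  exact absurd hd0 hneg.ne

/-! ## §2 The two-sided sharp inequality -/

/-- **`|S(v)| ≤ c Z(v)^{3/4} Pal(v)^{3/4}` on the admissible class**: the class is symmetric under `v ↦ −v`, which flips the sign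
of `S` and preserves `Z`, `Pal`. [folklore] -/
theorem abs_stretching_le {c : ℝ} {v : EuclideanSpace ℝ (Fin 3) → EuclideanSpace ℝ (Fin 3)}
    (hv : ContDiff ℝ (⊤ : ℕ∞) v ∧ VectorCalculus.IsDivFree v ∧ (∫⁻ x, ‖iteratedFDeriv ℝ 0 v x‖ₑ ^ 2 < ⊤) ∧
      (∫⁻ x, ‖iteratedFDeriv ℝ 1 v x‖ₑ ^ 2 < ⊤) ∧ (∫⁻ x, ‖iteratedFDeriv ℝ 2 v x‖ₑ ^ 2 < ⊤))
    (hc : ∀ v : EuclideanSpace ℝ (Fin 3) → EuclideanSpace ℝ (Fin 3), (ContDiff ℝ (⊤ : ℕ∞) v ∧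
      VectorCalculus.IsDivFree v ∧ (∫⁻ x, ‖iteratedFDeriv ℝ 0 v x‖ₑ ^ 2 < ⊤) ∧
      (∫⁻ x, ‖iteratedFDeriv ℝ 1 v x‖ₑ ^ 2 < ⊤) ∧ (∫⁻ x, ‖iteratedFDeriv ℝ 2 v x‖ₑ ^ 2 < ⊤)) →
      (∫ x, ⟪curl v x, fderiv ℝ v x (curl v x)⟫_ℝ) ≤
        c * (∫ x, ‖curl v x‖ ^ 2) ^ (3 / 4 : ℝ) * (∫ x, frobeniusNormSq (fderiv ℝ (curl v) x)) ^ (3 / 4 : ℝ)) :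
    |∫ x, ⟪curl v x, fderiv ℝ v x (curl v x)⟫_ℝ| ≤
      c * (∫ x, ‖curl v x‖ ^ 2) ^ (3 / 4 : ℝ) * (∫ x, frobeniusNormSq (fderiv ℝ (curl v) x)) ^ (3 / 4 : ℝ) := by
  refine abs_le.2 ⟨?_, hc v hv⟩
  have hvd : Differentiable ℝ v := hv.1.differentiable (by simp)
  have h := hc _ (admissible_const_smul hv (-1))
  rw [stretching_const_smul hvd (-1), enstrophy_const_smul hvd (-1), palinstrophy_const_smul (hv.1.of_le (by norm_cast)) (-1)] at h
  norm_num at h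
  linarith

/-! ## §3 The second variation inequality -/

/-- **Second variation inequality of the Lu–Doering extremisers.** Let `c` be an admissible constant and let the admissible `m`
with `Z(m), Pal(m) > 0` saturate it. Then for every admissible `h`, with `Z, P, S` the values at `m`, `B = ∫⟪curl m, curl h⟫`,
`P₁ = ∫Σᵢ⟪D curl m eᵢ, D curl h eᵢ⟫`, `S₁, S₂` the first- and second-order mixed stretching terms:
`0 ≤ c⁴(24 Z B² P³ + 6 Z² Z(h) P³ + 72 Z² P² B P₁ + 24 Z³ P P₁² + 6 Z³ P² Pal(h)) − 12 S² S₁² − 8 S³ S₂`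
(`p(s) = c⁴Z(m+sh)³Pal(m+sh)³ − S(m+sh)⁴ ≥ 0 = p(0)`, so `p''(0) ≥ 0`). [cite: LuDoering2008, §3] -/
theorem secondVariation_of_maximiser {c : ℝ} {m h : EuclideanSpace ℝ (Fin 3) → EuclideanSpace ℝ (Fin 3)}
    (hm : ContDiff ℝ (⊤ : ℕ∞) m ∧ VectorCalculus.IsDivFree m ∧ (∫⁻ x, ‖iteratedFDeriv ℝ 0 m x‖ₑ ^ 2 < ⊤) ∧
      (∫⁻ x, ‖iteratedFDeriv ℝ 1 m x‖ₑ ^ 2 < ⊤) ∧ (∫⁻ x, ‖iteratedFDeriv ℝ 2 m x‖ₑ ^ 2 < ⊤))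
    (hh : ContDiff ℝ (⊤ : ℕ∞) h ∧ VectorCalculus.IsDivFree h ∧ (∫⁻ x, ‖iteratedFDeriv ℝ 0 h x‖ₑ ^ 2 < ⊤) ∧
      (∫⁻ x, ‖iteratedFDeriv ℝ 1 h x‖ₑ ^ 2 < ⊤) ∧ (∫⁻ x, ‖iteratedFDeriv ℝ 2 h x‖ₑ ^ 2 < ⊤))
    (hc : ∀ v : EuclideanSpace ℝ (Fin 3) → EuclideanSpace ℝ (Fin 3), (ContDiff ℝ (⊤ : ℕ∞) v ∧
      VectorCalculus.IsDivFree v ∧ (∫⁻ x, ‖iteratedFDeriv ℝ 0 v x‖ₑ ^ 2 < ⊤) ∧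
      (∫⁻ x, ‖iteratedFDeriv ℝ 1 v x‖ₑ ^ 2 < ⊤) ∧ (∫⁻ x, ‖iteratedFDeriv ℝ 2 v x‖ₑ ^ 2 < ⊤)) →
      (∫ x, ⟪curl v x, fderiv ℝ v x (curl v x)⟫_ℝ) ≤
        c * (∫ x, ‖curl v x‖ ^ 2) ^ (3 / 4 : ℝ) * (∫ x, frobeniusNormSq (fderiv ℝ (curl v) x)) ^ (3 / 4 : ℝ))
    (hZ : 0 < ∫ x, ‖curl m x‖ ^ 2) (hP : 0 < ∫ x, frobeniusNormSq (fderiv ℝ (curl m) x))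
    (hmax : (∫ x, ⟪curl m x, fderiv ℝ m x (curl m x)⟫_ℝ) =
      c * (∫ x, ‖curl m x‖ ^ 2) ^ (3 / 4 : ℝ) * (∫ x, frobeniusNormSq (fderiv ℝ (curl m) x)) ^ (3 / 4 : ℝ)) :
    0 ≤ c ^ 4 * (24 * (∫ x, ‖curl m x‖ ^ 2) * (∫ x, ⟪curl m x, curl h x⟫_ℝ) ^ 2 *
          (∫ x, frobeniusNormSq (fderiv ℝ (curl m) x)) ^ 3 +
        6 * (∫ x, ‖curl m x‖ ^ 2) ^ 2 * (∫ x, ‖curl h x‖ ^ 2) * (∫ x, frobeniusNormSq (fderiv ℝ (curl m) x)) ^ 3 +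
        72 * (∫ x, ‖curl m x‖ ^ 2) ^ 2 * (∫ x, frobeniusNormSq (fderiv ℝ (curl m) x)) ^ 2 *
          (∫ x, ⟪curl m x, curl h x⟫_ℝ) * (∫ x, ∑ i, ⟪fderiv ℝ (curl m) x (EuclideanSpace.basisFun (Fin 3) ℝ i),
            fderiv ℝ (curl h) x (EuclideanSpace.basisFun (Fin 3) ℝ i)⟫_ℝ) +
        24 * (∫ x, ‖curl m x‖ ^ 2) ^ 3 * (∫ x, frobeniusNormSq (fderiv ℝ (curl m) x)) *
          (∫ x, ∑ i, ⟪fderiv ℝ (curl m) x (EuclideanSpace.basisFun (Fin 3) ℝ i),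
            fderiv ℝ (curl h) x (EuclideanSpace.basisFun (Fin 3) ℝ i)⟫_ℝ) ^ 2 +
        6 * (∫ x, ‖curl m x‖ ^ 2) ^ 3 * (∫ x, frobeniusNormSq (fderiv ℝ (curl m) x)) ^ 2 *
          (∫ x, frobeniusNormSq (fderiv ℝ (curl h) x))) -
      12 * (∫ x, ⟪curl m x, fderiv ℝ m x (curl m x)⟫_ℝ) ^ 2 *
        ((∫ x, ⟪curl h x, fderiv ℝ m x (curl m x)⟫_ℝ) + (∫ x, ⟪curl m x, fderiv ℝ h x (curl m x)⟫_ℝ) +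
          (∫ x, ⟪curl m x, fderiv ℝ m x (curl h x)⟫_ℝ)) ^ 2 -
      8 * (∫ x, ⟪curl m x, fderiv ℝ m x (curl m x)⟫_ℝ) ^ 3 *
        ((∫ x, ⟪curl h x, fderiv ℝ h x (curl m x)⟫_ℝ) + (∫ x, ⟪curl h x, fderiv ℝ m x (curl h x)⟫_ℝ) +
          (∫ x, ⟪curl m x, fderiv ℝ h x (curl h x)⟫_ℝ)) := by
  -- the two-sided inequality along the segment, in polynomial form
  have hineq : ∀ s : ℝ, |(∫ x, ⟪curl m x, fderiv ℝ m x (curl m x)⟫_ℝ) +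
      s * ((∫ x, ⟪curl h x, fderiv ℝ m x (curl m x)⟫_ℝ) + (∫ x, ⟪curl m x, fderiv ℝ h x (curl m x)⟫_ℝ) +
        (∫ x, ⟪curl m x, fderiv ℝ m x (curl h x)⟫_ℝ)) +
      s ^ 2 * ((∫ x, ⟪curl h x, fderiv ℝ h x (curl m x)⟫_ℝ) + (∫ x, ⟪curl h x, fderiv ℝ m x (curl h x)⟫_ℝ) +
        (∫ x, ⟪curl m x, fderiv ℝ h x (curl h x)⟫_ℝ)) +
      s ^ 3 * (∫ x, ⟪curl h x, fderiv ℝ h x (curl h x)⟫_ℝ)| ≤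
      c * ((∫ x, ‖curl m x‖ ^ 2) + 2 * s * (∫ x, ⟪curl m x, curl h x⟫_ℝ) + s ^ 2 * ∫ x, ‖curl h x‖ ^ 2) ^ (3 / 4 : ℝ) *
        ((∫ x, frobeniusNormSq (fderiv ℝ (curl m) x)) +
          2 * s * (∫ x, ∑ i, ⟪fderiv ℝ (curl m) x (EuclideanSpace.basisFun (Fin 3) ℝ i),
            fderiv ℝ (curl h) x (EuclideanSpace.basisFun (Fin 3) ℝ i)⟫_ℝ) +
          s ^ 2 * ∫ x, frobeniusNormSq (fderiv ℝ (curl h) x)) ^ (3 / 4 : ℝ) := by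
    intro s
    have h0 := abs_stretching_le (admissible_segment hm hh s) hc
    rwa [stretching_variation hm hh s, enstrophy_variation hm.1 hm.2.2.2.1 hh.1 hh.2.2.2.1 s,
      palinstrophy_variation hm.1 hm.2.2.2.2 hh.1 hh.2.2.2.2 s] at h0
  have hZs : ∀ s : ℝ, 0 ≤ (∫ x, ‖curl m x‖ ^ 2) + 2 * s * (∫ x, ⟪curl m x, curl h x⟫_ℝ) + s ^ 2 * ∫ x, ‖curl h x‖ ^ 2 :=
    fun s => by
    rw [← enstrophy_variation hm.1 hm.2.2.2.1 hh.1 hh.2.2.2.1 s]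
    exact integral_nonneg fun x => by positivity
  have hPs : ∀ s : ℝ, 0 ≤ (∫ x, frobeniusNormSq (fderiv ℝ (curl m) x)) +
      2 * s * (∫ x, ∑ i, ⟪fderiv ℝ (curl m) x (EuclideanSpace.basisFun (Fin 3) ℝ i),
        fderiv ℝ (curl h) x (EuclideanSpace.basisFun (Fin 3) ℝ i)⟫_ℝ) + s ^ 2 * ∫ x, frobeniusNormSq (fderiv ℝ (curl h) x) :=
    fun s => by
    rw [← palinstrophy_variation hm.1 hm.2.2.2.2 hh.1 hh.2.2.2.2 s]
    exact integral_nonneg fun x => frobeniusNormSq_nonneg _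
  -- abbreviations
  set S0 : ℝ := ∫ x, ⟪curl m x, fderiv ℝ m x (curl m x)⟫_ℝ with hS0
  set S1 : ℝ := (∫ x, ⟪curl h x, fderiv ℝ m x (curl m x)⟫_ℝ) + (∫ x, ⟪curl m x, fderiv ℝ h x (curl m x)⟫_ℝ) +
    (∫ x, ⟪curl m x, fderiv ℝ m x (curl h x)⟫_ℝ) with hS1
  set S2 : ℝ := (∫ x, ⟪curl h x, fderiv ℝ h x (curl m x)⟫_ℝ) + (∫ x, ⟪curl h x, fderiv ℝ m x (curl h x)⟫_ℝ) +
    (∫ x, ⟪curl m x, fderiv ℝ h x (curl h x)⟫_ℝ) with hS2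
  set S3 : ℝ := ∫ x, ⟪curl h x, fderiv ℝ h x (curl h x)⟫_ℝ with hS3
  set Z0 : ℝ := ∫ x, ‖curl m x‖ ^ 2 with hZ0
  set B : ℝ := ∫ x, ⟪curl m x, curl h x⟫_ℝ with hB
  set Zh : ℝ := ∫ x, ‖curl h x‖ ^ 2 with hZh
  set P0 : ℝ := ∫ x, frobeniusNormSq (fderiv ℝ (curl m) x) with hP0
  set P1 : ℝ := ∫ x, ∑ i, ⟪fderiv ℝ (curl m) x (EuclideanSpace.basisFun (Fin 3) ℝ i),
    fderiv ℝ (curl h) x (EuclideanSpace.basisFun (Fin 3) ℝ i)⟫_ℝ with hP1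
  set Ph : ℝ := ∫ x, frobeniusNormSq (fderiv ℝ (curl h) x) with hPh
  -- `c ≥ 0`
  have hc0 : 0 ≤ c := by
    have h0 : |S0| ≤ c * Z0 ^ (3 / 4 : ℝ) * P0 ^ (3 / 4 : ℝ) := abs_stretching_le hm hc
    have hpos : 0 < Z0 ^ (3 / 4 : ℝ) * P0 ^ (3 / 4 : ℝ) := mul_pos (Real.rpow_pos_of_pos hZ _) (Real.rpow_pos_of_pos hP _)
    nlinarith [abs_nonneg S0]
  -- the constraint polynomial is nonnegative and vanishes at `0`
  have hp0 : c ^ 4 * (Z0 + 2 * 0 * B + 0 ^ 2 * Zh) ^ 3 * (P0 + 2 * 0 * P1 + 0 ^ 2 * Ph) ^ 3 -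
      (S0 + 0 * S1 + 0 ^ 2 * S2 + 0 ^ 3 * S3) ^ 4 = 0 := by
    simp only [mul_zero, zero_mul, add_zero, zero_pow two_ne_zero, zero_pow three_ne_zero]
    rw [hmax, mul_pow, mul_pow, rpow_three_quarters_pow_four hZ.le, rpow_three_quarters_pow_four hP.le, sub_self]
  have hmin : ∀ s : ℝ, c ^ 4 * (Z0 + 2 * 0 * B + 0 ^ 2 * Zh) ^ 3 * (P0 + 2 * 0 * P1 + 0 ^ 2 * Ph) ^ 3 -
      (S0 + 0 * S1 + 0 ^ 2 * S2 + 0 ^ 3 * S3) ^ 4 ≤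
      c ^ 4 * (Z0 + 2 * s * B + s ^ 2 * Zh) ^ 3 * (P0 + 2 * s * P1 + s ^ 2 * Ph) ^ 3 -
      (S0 + s * S1 + s ^ 2 * S2 + s ^ 3 * S3) ^ 4 := by
    intro s
    rw [hp0, sub_nonneg]
    have h1 := hineq s
    have hK : 0 ≤ c * (Z0 + 2 * s * B + s ^ 2 * Zh) ^ (3 / 4 : ℝ) * (P0 + 2 * s * P1 + s ^ 2 * Ph) ^ (3 / 4 : ℝ) :=
      mul_nonneg (mul_nonneg hc0 (Real.rpow_nonneg (hZs s) _)) (Real.rpow_nonneg (hPs s) _)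
    have h4 : |S0 + s * S1 + s ^ 2 * S2 + s ^ 3 * S3| ^ 4 ≤
        (c * (Z0 + 2 * s * B + s ^ 2 * Zh) ^ (3 / 4 : ℝ) * (P0 + 2 * s * P1 + s ^ 2 * Ph) ^ (3 / 4 : ℝ)) ^ 4 :=
      pow_le_pow_left₀ (abs_nonneg _) h1 4
    rw [pow_abs, abs_of_nonneg (by positivity : (0 : ℝ) ≤ (S0 + s * S1 + s ^ 2 * S2 + s ^ 3 * S3) ^ 4), mul_pow, mul_pow,
      rpow_three_quarters_pow_four (hZs s), rpow_three_quarters_pow_four (hPs s)] at h4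
    exact h4
  exact (secondOrder_of_min (fun s => hasDerivAt_constraintPoly (c ^ 4) Z0 B Zh P0 P1 Ph S0 S1 S2 S3 s)
    (hasDerivAt_constraintPoly_deriv_zero (c ^ 4) Z0 B Zh P0 P1 Ph S0 S1 S2 S3) hmin).2

/-- **Second variation inequality, normal form, with the Euler–Lagrange identity substituted.** For an admissible `m` with
`Z(m) = Pal(m) = 1` saturating the admissible constant `c > 0` (`S(m) = c`) and every admissible `h`:
`8 S₂(m;h) ≤ c (6 (Z(h) + Pal(h)) + 18 B P₁ − 3 B² − 3 P₁²)` — the constrained Hessian of the Lu–Doering efficiency at a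
maximiser is negative semi-definite on admissible directions. [cite: LuDoering2008, §3] -/
theorem secondVariation_of_normalisedMaximiser {c : ℝ} {m h : EuclideanSpace ℝ (Fin 3) → EuclideanSpace ℝ (Fin 3)}
    (hm : ContDiff ℝ (⊤ : ℕ∞) m ∧ VectorCalculus.IsDivFree m ∧ (∫⁻ x, ‖iteratedFDeriv ℝ 0 m x‖ₑ ^ 2 < ⊤) ∧
      (∫⁻ x, ‖iteratedFDeriv ℝ 1 m x‖ₑ ^ 2 < ⊤) ∧ (∫⁻ x, ‖iteratedFDeriv ℝ 2 m x‖ₑ ^ 2 < ⊤))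
    (hh : ContDiff ℝ (⊤ : ℕ∞) h ∧ VectorCalculus.IsDivFree h ∧ (∫⁻ x, ‖iteratedFDeriv ℝ 0 h x‖ₑ ^ 2 < ⊤) ∧
      (∫⁻ x, ‖iteratedFDeriv ℝ 1 h x‖ₑ ^ 2 < ⊤) ∧ (∫⁻ x, ‖iteratedFDeriv ℝ 2 h x‖ₑ ^ 2 < ⊤))
    (hc : ∀ v : EuclideanSpace ℝ (Fin 3) → EuclideanSpace ℝ (Fin 3), (ContDiff ℝ (⊤ : ℕ∞) v ∧
      VectorCalculus.IsDivFree v ∧ (∫⁻ x, ‖iteratedFDeriv ℝ 0 v x‖ₑ ^ 2 < ⊤) ∧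
      (∫⁻ x, ‖iteratedFDeriv ℝ 1 v x‖ₑ ^ 2 < ⊤) ∧ (∫⁻ x, ‖iteratedFDeriv ℝ 2 v x‖ₑ ^ 2 < ⊤)) →
      (∫ x, ⟪curl v x, fderiv ℝ v x (curl v x)⟫_ℝ) ≤
        c * (∫ x, ‖curl v x‖ ^ 2) ^ (3 / 4 : ℝ) * (∫ x, frobeniusNormSq (fderiv ℝ (curl v) x)) ^ (3 / 4 : ℝ))
    (hcpos : 0 < c) (hZ1 : (∫ x, ‖curl m x‖ ^ 2) = 1) (hP1 : (∫ x, frobeniusNormSq (fderiv ℝ (curl m) x)) = 1)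
    (hmax : (∫ x, ⟪curl m x, fderiv ℝ m x (curl m x)⟫_ℝ) = c) :
    8 * ((∫ x, ⟪curl h x, fderiv ℝ h x (curl m x)⟫_ℝ) + (∫ x, ⟪curl h x, fderiv ℝ m x (curl h x)⟫_ℝ) +
        (∫ x, ⟪curl m x, fderiv ℝ h x (curl h x)⟫_ℝ)) ≤
      c * (6 * ((∫ x, ‖curl h x‖ ^ 2) + ∫ x, frobeniusNormSq (fderiv ℝ (curl h) x)) +
        18 * (∫ x, ⟪curl m x, curl h x⟫_ℝ) * (∫ x, ∑ i, ⟪fderiv ℝ (curl m) x (EuclideanSpace.basisFun (Fin 3) ℝ i),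
          fderiv ℝ (curl h) x (EuclideanSpace.basisFun (Fin 3) ℝ i)⟫_ℝ) -
        3 * (∫ x, ⟪curl m x, curl h x⟫_ℝ) ^ 2 -
        3 * (∫ x, ∑ i, ⟪fderiv ℝ (curl m) x (EuclideanSpace.basisFun (Fin 3) ℝ i),
          fderiv ℝ (curl h) x (EuclideanSpace.basisFun (Fin 3) ℝ i)⟫_ℝ) ^ 2) := by
  have hmax' : (∫ x, ⟪curl m x, fderiv ℝ m x (curl m x)⟫_ℝ) =
      c * (∫ x, ‖curl m x‖ ^ 2) ^ (3 / 4 : ℝ) * (∫ x, frobeniusNormSq (fderiv ℝ (curl m) x)) ^ (3 / 4 : ℝ) := by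
    rw [hZ1, hP1, Real.one_rpow, mul_one, mul_one, hmax]
  have hEL := eulerLagrange_of_normalisedMaximiser hm hh hc hZ1 hP1 hmax
  have h2 := secondVariation_of_maximiser hm hh hc (by rw [hZ1]; exact one_pos) (by rw [hP1]; exact one_pos) hmax'
  rw [hZ1, hP1, hmax, hEL] at h2
  -- `h2 : 0 ≤ c⁴(24B² + 6Zh + 72BP₁ + 24P₁² + 6Ph) − 12c²((3/2)c(B+P₁))² − 8c³S₂`; divide by `c³ > 0`
  have hc3 : 0 < c ^ 3 := pow_pos hcpos 3
  nlinarith [h2, hc3]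
end SeqCore

end NearSaturationNearMaximiser

end Summit.NavierStokesRegularity.NavierStokesRegularity.Theorems

end
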